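import Literature.AnabelianGeometry.EtaleTheta.TemperedFrobenioidLaws
import Literature.AnabelianGeometry.EtaleTheta.RealifiedDivisorMonoidsOfRlf
import Literature.AnabelianGeometry.EtaleTheta.RealifiedDivisorMonoidsOfRlfWeak
import Literature.AnabelianGeometry.EtaleTheta.DivisorMonoidsOfGaloisCoveringConnected
import Literature.AnabelianGeometry.EtaleTheta.LogDivisorModelToy
import Literature.AnabelianGeometry.EtaleTheta.LogDivisorModelTateTower
import Literature.AnabelianGeometry.EtaleTheta.TemperedFrobenioidOfGaloisCoveringOneComponent
import Literature.AnabelianGeometry.EtaleTheta.TemperedFrobenioidOfGaloisCoveringTateTower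

/-!
# [EtTh] Def. 3.1 (ii) ERRATUM E2 vs Prop. 3.2 (iii): the tempered-meromorphic ROOT LAW is UNSATISFIABLE inside the
# «coverings dominated by ONE `Z^log_∞`» model of Def. 3.3 (iii) — a kernel no-go fixing the v2 data direction

S. Mochizuki, *The étale theta function …*, Publ. RIMS **45** (2009) [MochizukiEtTh2009], §3: Def. 3.1 (ii) p.70
(log-meromorphic functions on `Z^log_∞`), **Prop. 3.2 (iii) p.70** («Let `f` be a nonzero meromorphic function on
`Z_∞` such that for every `N ∈ ℕ_{≥1}` there exists a meromorphic function `g_N` on `Z_∞` with `g_N^N = f`.  Then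
`f = 1`»), Def. 3.3 (iii) p.73 (`Φ₀(Y^log)`, `B₀(Y^log)` as invariants on the universal combinatorial covering),
Def. 3.6 (ii)(b) p.77 («the homomorphism `F(A) → (Φ^{bs-fld})^gp(A)` is nonzero»), Prop. 4.2 (iii) proof p.89;
ERRATUM E2 = [IUTchI] Rmk. 3.2.4 (i)(a)/(iv)(A) («tempered-meromorphic»: `f` admits an `N`-th root over SOME
TEMPERED COVERING, for every `N`).  abc-iut cell, layer L2; v-next census item A10 («v2 direction», post-window);
seat abc-iut-L2-t3 (gen 5), owner of Def. 3.1–3.6 / E2.  PROOF-ONLY over landed interfaces except ONE `Prop`-valued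
predicate on MODEL data (`GaloisAction.RootLaw`, a one-field `structure … : Prop`, class (c)); nothing landed is edited.

THE POINT.  The tree models Def. 3.3 (iii) (abc-iut-w6-d058's `LogDivisorModel.GaloisAction`, `DivisorMonoids.ofGaloisAction
(Connected)`) by ONE universal combinatorial covering `Z^log_∞` with its function group `Fn = Mero(Z_∞)` (interface
`LogDivisorModel`, carrying Prop. 3.2 (iii) as the field `eq_one_of_forall_exists_pow_eq`) and by the coverings
`Y ↔ S = G/H` DOMINATED BY `Z^log_∞`, with `B₀(S) := Hom_G(S, Mero(Z_∞))`: ALL objects share the value group `Fn`.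
For such `Y` print agrees (`Z_∞(Y) = Z_∞`).  But the E2 root condition (a) — the binder `hR₀` of Prop. 4.2 (iii),
named `TemperedFrobenioid.BaseRootLaw` (p443354) — asks, for every `N`, an `N`-th root of `b ∈ B₀(Y)` in `B₀(Y')`
over some cover `Y' → Y`; if `Y'` is again dominated by the same `Z_∞`, the root's VALUES are `N`-th roots IN
`Mero(Z_∞)` of the values of `b` (covering maps of connected `G`-sets are surjective), so every value of `b` is
infinitely divisible in `Mero(Z_∞)`, hence `= 1` by Prop. 3.2 (iii).  Consequently (all PROVED here):

* §1 `GaloisAction.RootLaw A` (E2 (a) read inside the model: roots over connected covers dominated by `Z_∞`) holds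
  IFF `B₀(S) = 1` for every connected `S` (`rootLaw_iff_bZero_trivial`); it holds at the trivial `toy`
  (`rootLaw_trivial_toy`) and at nothing with a non-constant function.
* §2/§2′ For EVERY tempered Frobenioid of monoid type `ℤ` over the constructed Def. 3.6 (i) data
  `ofRlfZWeak (ofGaloisActionConnected A hZ) hpf` (weak vocabulary of record) resp. `ofRlfZ …` (printed vocabulary)
  — ANY base category `D`, ANY base functor, ANY `IG` —: `BaseRootLaw IG` forces `B₀^ℤ(Y_X) = 1` at every
  `IG`-object `X` (`bΛ_eq_one_of_baseRootLaw`), contradicting Def. 3.6 (ii)(b) there (`not_isIG_of_baseRootLaw`);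
  so **`BaseRootLaw IG` is REFUTED as soon as one `IG`-object exists** (`not_baseRootLaw_of_exists(_ofRlfZ)`) — in
  §4, `IG` = «Galois», and `A_⊙` is Galois.
* §3 NON-VACUOUS: at abc-iut-w6-d048's one-component tempered Frobenioid (p444302, printed vocabulary) and at its
  tempered Frobenioid OF THE TATE TOWER (p446077, weak data of record) `BaseRootLaw ⊤` FAILS
  (`OneCompFrd.not_baseRootLaw_top`, `TateTowerFrd.not_baseRootLaw_top`); at abc-iut-w6-d058's Tate tower (p444705)
  the model-level `RootLaw` FAILS (`TateTower.not_rootLaw`: the Tate coordinate `U` is a non-constant element of `B₀`).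

READING (no side taken; a statement about OUR model class, not about print): print's Def. 3.3 (iii) (p.73–74) takes
`B₀(Y^log) := lim_{→} Mero(Z^log_∞)^{Gal(Z^log_∞/Y^log)}` over the `Δ^fil`-CLOSURES `Z^log_∞ → Y^log` of `Y^log`, whose index
`i_H` in the tempered filter depends on `Y ↔ H` (Def. 3.3 (i)(c), (ii)); so the value group `Mero(Z_∞^{(i_H)})` GROWS with
`Y` — the Kummer-type tempered coverings `Y'` carrying `N`-th roots have deeper `Δ^fil`-closures, NOT dominated by
`Z_∞^{(i_H)}`, and Prop. 3.2 (iii) constrains each `Mero(Z_∞^{(i)})` separately, so (a) is consistent there (label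
F-L2t3g5-1, L2-lead R342; design memo `VNEXT-LogDivisorModelV2-DESIGN.md` of this seat).
Hence the census item A10 cannot be served by a predicate on the present data: the v2 Def. 3.3 (iii) datum must index
the function groups by the covering (`Mero : D₀ᵒᵖ ⥤ Grp` with Prop. 3.2 (iii) objectwise and roots ACROSS objects),
i.e. `D₀` must contain coverings not dominated by a single `Z^log_∞`.  Until then every `Λ = ℤ` discharge of
Prop. 4.2 (iii) at «constructed data» binds an unsatisfiable `hR₀` (label F-L2t3g5-1, L2-lead R342), while the
abstract `BaseRootLaw` over a free `RealifiedDivisorMonoids` remains a consistent binder (`ofRlfQ`/`ofRlfR` ✓, `Toy` ✗,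
p443354) with a positive `Λ = ℤ` instance OUTSIDE this model class at abc-iut-w6-d053's Kummer toy tower
(`ToyTower.baseRootLaw_A10`, p445630).
HONEST FRAMING: refereed pre-IUT material; kernel facts about the cell's typed model class; typed ≠ proved; nothing
here bears on the disputed [IUTchIII] Cor. 3.12.
-/

noncomputable section

namespace Literature.AnabelianGeometry.EtaleTheta

open CategoryTheory Opposite Function Literature.AlgebraicGeometry.Frobenioids

universe u u₀ v₀

/-! ### §1 The root law INSIDE the model: equivalent to triviality of `B₀` on connected coverings -/

namespace LogDivisorModel.GaloisAction

variable {Z : LogDivisorModel.{u}} {G : Type u} [Group G] (A : Z.GaloisAction G)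

/-- **E2 condition (a) read inside the «dominated by `Z^log_∞`» model**: for every `N ≥ 1`, every connected covering
`S` and every `b ∈ B₀(S) = Hom_G(S, Mero(Z_∞))` there are a connected covering `S' → S` and `r ∈ B₀(S')` with
`r^N = b|_{S'}` ([IUTchI] Rmk. 3.2.4 (i)(a) «admits an `N`-th root over some tempered covering», with the covering
ranging over the model's `D₀`).  Class (c) predicate on MODEL data. [cite: MochizukiEtTh2009, Def 3.1 (ii) p.70] -/
@[mk_iff] structure RootLaw : Prop where
  /-- every `b ∈ B₀(S)`, `S` connected, has an `N`-th root in `B₀(S')` over some connected covering `S' → S` -/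
  exists_root : ∀ (N : ℕ+) (S : Action (Type u) G), isConnectedGSet S → ∀ b : A.bZero S,
    ∃ (S' : Action (Type u) G) (_ : isConnectedGSet S') (f : S' ⟶ S) (r : A.bZero S'),
      r ^ (N : ℕ) = A.bZeroPull f b

/-- If `b|_{S'} = r^N` along a SURJECTIVE covering map, every value of `b` is an `N`-th power in `Mero(Z_∞)` (the
value group is the same for `S` and `S'`). [cite: MochizukiEtTh2009, Def 3.3 (iii) p.73] -/
theorem exists_pow_eq_apply_of_root {S S' : Action (Type u) G} (f : S' ⟶ S) (hf : Surjective f.hom)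
    (b : A.bZero S) (r : A.bZero S') (N : ℕ) (h : r ^ N = A.bZeroPull f b) (s : S.V) :
    ∃ g : Z.Fn, g ^ N = b.1 s := by
  obtain ⟨s', rfl⟩ := hf s
  refine ⟨r.1 s', ?_⟩
  -- `(r ^ N).1 s' = (r.1 s') ^ N` and `(f^* b).1 s' = b.1 (f s')` hold definitionally
  exact congrArg (fun x : A.bZero S' => x.1 s') h

/-- **Prop. 3.2 (iii) kills the root law**: under `RootLaw`, every `b ∈ B₀(S)` over a connected covering `S` is
trivial — its values are infinitely divisible nonzero meromorphic functions on `Z_∞`, hence `= 1`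
(`LogDivisorModel.eq_one_of_forall_exists_pow_eq`). [cite: MochizukiEtTh2009, Prop 3.2 (iii) p.70] -/
theorem bZero_eq_one_of_rootLaw (h : A.RootLaw) {S : Action (Type u) G} (hS : isConnectedGSet S)
    (b : A.bZero S) : b = 1 := by
  apply Subtype.ext
  funext s
  apply Z.eq_one_of_forall_exists_pow_eq
  intro N
  obtain ⟨S', hS', f, r, hr⟩ := h.exists_root N S hS b
  exact A.exists_pow_eq_apply_of_root f (hom_surjective_of_isConnectedGSet hS' hS f) b r N hr s

/-- **`RootLaw` ⟺ `B₀` is trivial on every connected covering** (⇐: the trivial root `r := 1` over `S' := S`).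
So inside this model class E2 (a) is satisfiable only degenerately. [cite: MochizukiEtTh2009, Prop 3.2 (iii) p.70] -/
theorem rootLaw_iff_bZero_trivial :
    A.RootLaw ↔ ∀ S : Action (Type u) G, isConnectedGSet S → ∀ b : A.bZero S, b = 1 := by
  refine ⟨fun h S hS b => A.bZero_eq_one_of_rootLaw h hS b, fun h => ⟨fun N S hS b => ⟨S, hS, 𝟙 S, 1, ?_⟩⟩⟩
  rw [h S hS b, one_pow, map_one]

/-- NV (consistency): the root law HOLDS at the trivial model `toy` (where `Mero(Z_∞) = 1`), for any group and the
trivial action. [cite: MochizukiEtTh2009, Def 3.1 (ii) p.70] -/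
theorem rootLaw_trivial_toy (G : Type) [Group G] : (GaloisAction.trivial LogDivisorModel.toy G).RootLaw :=
  (rootLaw_iff_bZero_trivial _).2 fun _ _ _ =>
    Subtype.ext (funext fun _ => @Subsingleton.elim _ (inferInstanceAs (Subsingleton PUnit.{1})) _ _)

end LogDivisorModel.GaloisAction

/-! ### §2 Consequence for tempered Frobenioids of monoid type `ℤ` over the constructed data: `BaseRootLaw` refuted -/

namespace TemperedFrobenioid

open LogDivisorModel.GaloisAction

variable {Z : LogDivisorModel.{u}} {G : Type u} [Group G] (A : Z.GaloisAction G) (hZ : Z.CuspLaws)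
  (hpf : ∀ Y : ((isConnectedGSet (G := G)).FullSubcategory)ᵒᵖ,
    IsPerfFactorialCof ((DivisorMonoids.ofGaloisActionConnected A hZ).Φ₀.obj Y))
  {D : Type u₀} [Category.{v₀} D] {VD : FrdICatStub.{u₀, v₀, u} D}
  (tf : TemperedFrobenioid
    (RealifiedDivisorMonoids.ofRlfZWeak (DivisorMonoids.ofGaloisActionConnected A hZ) hpf) D VD)

/-- **`BaseRootLaw IG` forces `B₀^ℤ(Y_X) = 1` at every `IG`-object `X`** of ANY tempered Frobenioid of monoid type
`ℤ` over the constructed Def. 3.6 (i) data of the connected coverings dominated by `Z^log_∞` (any base category and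
base functor): the root over the `IG`-cover `X' ⟶ X` lives in the SAME `Mero(Z_∞)`, the base map is a surjection of
connected `G`-sets, so every value of `b` is infinitely divisible, hence trivial by Prop. 3.2 (iii).
[cite: MochizukiEtTh2009, Prop 3.2 (iii) p.70] -/
theorem bΛ_eq_one_of_baseRootLaw (IG : D → Prop) (h : tf.BaseRootLaw IG) (X : D) (hX : IG X)
    (b : (RealifiedDivisorMonoids.ofRlfZWeak (DivisorMonoids.ofGaloisActionConnected A hZ) hpf).BΛ.obj
      (op (tf.base.obj X))) : b = 1 := by
  apply Subtype.ext
  funext s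
  apply Z.eq_one_of_forall_exists_pow_eq
  intro N
  obtain ⟨X', hX', c, b', hb'⟩ := h N X hX b
  obtain ⟨s', rfl⟩ := hom_surjective_of_isConnectedGSet (tf.base.obj X').property (tf.base.obj X).property
    (tf.base.map c).hom s
  refine ⟨b'.1 s', ?_⟩
  -- values: `(b' ^ N).1 s' = (b'.1 s') ^ N`, `((B₀^ℤ(Y_c)) b).1 s' = b.1 (Y_c s')` — definitional
  exact congrArg
    (fun x : (RealifiedDivisorMonoids.ofRlfZWeak (DivisorMonoids.ofGaloisActionConnected A hZ) hpf).BΛ.obj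
      (op (tf.base.obj X')) => x.1 s') hb'

/-- **Hence no `IG`-object can exist under `BaseRootLaw IG`**: at an `IG`-object `X`, Def. 3.6 (ii)(b) («`F(A) →
(Φ^{bs-fld})^gp(A)` nonzero», the field `exists_FΛ_div_ne`) produces `b ∈ F^ℤ(Y_X) ⊆ B₀^ℤ(Y_X)` with divisor
`[x] − [y]`, `x ≠ y` in the (integral) realified divisor monoid; but `b = 1`. [cite: MochizukiEtTh2009, Def 3.6 (ii) p.77] -/
theorem not_isIG_of_baseRootLaw (IG : D → Prop) (h : tf.BaseRootLaw IG) (X : D) : ¬ IG X := by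
  intro hX
  obtain ⟨b, -, x, -, y, -, hxy, hdiv⟩ := tf.exists_FΛ_div_ne (op X)
  have hb : b = 1 := tf.bΛ_eq_one_of_baseRootLaw A hZ hpf IG h X hX b
  rw [hb, map_one, eq_comm, div_eq_one] at hdiv
  exact hxy ((IsPerfFactorialWeak.Rlf.isIntegral (hpf (op (tf.base.obj X))).weak).injective_of hdiv)

/-- **The E2 root law `BaseRootLaw` (census A10, binder `hR₀` of Prop. 4.2 (iii)) is REFUTED for every tempered
Frobenioid of monoid type `ℤ` over the «dominated by one `Z^log_∞`» data, as soon as one `IG`-object exists** (in §4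
`IG` = Galois objects, and the base point `A_⊙` is one).  The v2 Def. 3.3 (iii) datum must let the function groups
grow with the covering. [cite: MochizukiEtTh2009, Prop 4.2 (iii) p.89] -/
theorem not_baseRootLaw_of_exists (IG : D → Prop) (hIG : ∃ X : D, IG X) : ¬ tf.BaseRootLaw IG :=
  fun h => hIG.elim fun X hX => tf.not_isIG_of_baseRootLaw A hZ hpf IG h X hX

/-- In particular for the trivially true `IG` (every object a candidate cover): `BaseRootLaw ⊤` fails for every such
tempered Frobenioid (the base category `D` is nonempty, being connected). [cite: MochizukiEtTh2009, Prop 4.2 (iii) p.89] -/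
theorem not_baseRootLaw_top : ¬ tf.BaseRootLaw fun _ => True :=
  tf.not_baseRootLaw_of_exists A hZ hpf _ ⟨tf.isConnected.is_nonempty.some, trivial⟩

end TemperedFrobenioid

/-! ### §2′ The same over the PRINTED-vocabulary type-`ℤ` data `ofRlfZ` (strongly perf-factorial `Φ₀`) -/

namespace TemperedFrobenioid

open LogDivisorModel.GaloisAction

variable {Z : LogDivisorModel.{u}} {G : Type u} [Group G] (A : Z.GaloisAction G) (hZ : Z.CuspLaws)
  (hpf : ∀ Y : ((isConnectedGSet (G := G)).FullSubcategory)ᵒᵖ,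
    IsPerfFactorial ((DivisorMonoids.ofGaloisActionConnected A hZ).Φ₀.obj Y))
  {D : Type u₀} [Category.{v₀} D] {VD : FrdICatStub.{u₀, v₀, u} D}
  (tf : TemperedFrobenioid
    (RealifiedDivisorMonoids.ofRlfZ (DivisorMonoids.ofGaloisActionConnected A hZ) hpf) D VD)

/-- `ofRlfZ` twin of `bΛ_eq_one_of_baseRootLaw`: `BaseRootLaw IG` forces `B₀^ℤ(Y_X) = 1` at every `IG`-object.
[cite: MochizukiEtTh2009, Prop 3.2 (iii) p.70] -/
theorem bΛ_eq_one_of_baseRootLaw_ofRlfZ (IG : D → Prop) (h : tf.BaseRootLaw IG) (X : D) (hX : IG X)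
    (b : (RealifiedDivisorMonoids.ofRlfZ (DivisorMonoids.ofGaloisActionConnected A hZ) hpf).BΛ.obj
      (op (tf.base.obj X))) : b = 1 := by
  apply Subtype.ext
  funext s
  apply Z.eq_one_of_forall_exists_pow_eq
  intro N
  obtain ⟨X', hX', c, b', hb'⟩ := h N X hX b
  obtain ⟨s', rfl⟩ := hom_surjective_of_isConnectedGSet (tf.base.obj X').property (tf.base.obj X).property
    (tf.base.map c).hom s
  refine ⟨b'.1 s', ?_⟩
  exact congrArg
    (fun x : (RealifiedDivisorMonoids.ofRlfZ (DivisorMonoids.ofGaloisActionConnected A hZ) hpf).BΛ.obj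
      (op (tf.base.obj X')) => x.1 s') hb'

/-- `ofRlfZ` twin of `not_isIG_of_baseRootLaw`. [cite: MochizukiEtTh2009, Def 3.6 (ii) p.77] -/
theorem not_isIG_of_baseRootLaw_ofRlfZ (IG : D → Prop) (h : tf.BaseRootLaw IG) (X : D) : ¬ IG X := by
  intro hX
  obtain ⟨b, -, x, -, y, -, hxy, hdiv⟩ := tf.exists_FΛ_div_ne (op X)
  have hb : b = 1 := tf.bΛ_eq_one_of_baseRootLaw_ofRlfZ A hZ hpf IG h X hX b
  rw [hb, map_one, eq_comm, div_eq_one] at hdiv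
  exact hxy ((IsPerfFactorial.Rlf.isIntegral (hpf (op (tf.base.obj X)))).injective_of hdiv)

/-- `ofRlfZ` twin of `not_baseRootLaw_of_exists`: **`BaseRootLaw IG` is refuted as soon as one `IG`-object exists.**
[cite: MochizukiEtTh2009, Prop 4.2 (iii) p.89] -/
theorem not_baseRootLaw_of_exists_ofRlfZ (IG : D → Prop) (hIG : ∃ X : D, IG X) : ¬ tf.BaseRootLaw IG :=
  fun h => hIG.elim fun X hX => tf.not_isIG_of_baseRootLaw_ofRlfZ A hZ hpf IG h X hX

/-- `ofRlfZ` twin of `not_baseRootLaw_top`. [cite: MochizukiEtTh2009, Prop 4.2 (iii) p.89] -/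
theorem not_baseRootLaw_top_ofRlfZ : ¬ tf.BaseRootLaw fun _ => True :=
  tf.not_baseRootLaw_of_exists_ofRlfZ A hZ hpf _ ⟨tf.isConnected.is_nonempty.some, trivial⟩

end TemperedFrobenioid

/-! ### §3 NON-VACUOUS instances: the one-component `p`-adic Frobenioid and the Tate tower -/

/-- **At abc-iut-w6-d048's tempered Frobenioid of the one-component model** (the `p`-adic Frobenioid of a good-reduction
curve over the constructed connected Def. 3.3 (iii) data, p444302 — the class of §2′ is INHABITED): the E2 root law
`BaseRootLaw` FAILS (even for the trivially true `IG`).  Geometrically: the uniformiser `ϖ ∈ B₀` has no square root on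
the curve itself; its roots live on ramified coverings, which are not dominated by `Z_∞ = X`.
[cite: MochizukiEtTh2009, Prop 4.2 (iii) p.89] -/
theorem OneCompFrd.not_baseRootLaw_top (U : Type) [CommGroup U]
    (hU : ∀ u : U, (∀ N : ℕ+, ∃ g : U, g ^ (N : ℕ) = u) → u = 1)
    (R S : ((Discrete PUnit.{1})ᵒᵖ ⥤ CommMonCat.{0}) → Prop) :
    ¬ (OneCompFrd.temperedFrobenioidOneComp U hU R S).BaseRootLaw fun _ => True :=
  (OneCompFrd.temperedFrobenioidOneComp U hU R S).not_baseRootLaw_top_ofRlfZ _ _ _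

/-- **At abc-iut-w6-d048's tempered Frobenioid OF THE TATE TOWER** (p446077, the model of record: monoid type `ℤ`, WEAK
data `ofRlfZWeak (ofGaloisActionConnected TateTower.action TateTower.cuspLaws) hpf` — the class of §2 is INHABITED at a
non-degenerate model): the E2 root law `BaseRootLaw` FAILS. [cite: MochizukiEtTh2009, Prop 4.2 (iii) p.89] -/
theorem TateTowerFrd.not_baseRootLaw_top (R S : ((Discrete PUnit.{1})ᵒᵖ ⥤ CommMonCat.{0}) → Prop) :
    ¬ (TateTowerFrd.temperedFrobenioid R S).BaseRootLaw fun _ => True :=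
  (TateTowerFrd.temperedFrobenioid R S).not_baseRootLaw_top _ _ _

/-- **At abc-iut-w6-d058's Tate tower** (p444705; `G = ℤ` translating the chain, `B₀(Z_∞) ∋ U` the Tate coordinate):
the model-level root law FAILS — `B₀` of the regular covering is NOT trivial (`coordU ∉ F₀`), while `RootLaw` would
force it to be (`rootLaw_iff_bZero_trivial`).  So E2 (a) for `U` needs coverings outside the tower's `D₀` (the Kummer
coverings `U ↦ U^{1/N}`), exactly as in print. [cite: MochizukiEtTh2009, Def 3.1 (ii) p.70] -/
theorem LogDivisorModel.TateTower.not_rootLaw : ¬ LogDivisorModel.TateTower.action.RootLaw := fun h =>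
  LogDivisorModel.TateTower.coordU_not_mem_fZero (by
    rw [(LogDivisorModel.GaloisAction.rootLaw_iff_bZero_trivial _).1 h _
      LogDivisorModel.GaloisAction.isConnectedGSet_leftRegular LogDivisorModel.TateTower.coordU]
    exact Submonoid.one_mem _)

end Literature.AnabelianGeometry.EtaleTheta

end
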